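/-
Copyright (c) 2026 the pub-hodgecm-mathlib formalisation cell (harness21).  Prover seat hodgecm-mathlib-K2E3-p12 (g8), Track B ∕ K2-LIT, h413 = `stmt-HodgeConjecture-24833`,
line `K2_E1_TraceFormulaBeta`, 5Res ROADCARD (154)∕(277) §3: the `hSD` letter of ★ `K2E1ChiSectionPlancherelSelfDualCMTwo` :184 at GENERAL RANK — the section pairing `B_z` of ★ VectorGram
PACKAGED as an operator family `M z` on `span{v_a}` by ★ `K2E1SpanOperatorOfEntries.exists_family_span_of_entries` (K2E4-p10) for a linearly independent family of `L²(K_U)`-classes.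
-/
import Summits.HodgeConjecture.HodgeConjecture.Theorems.K2E1ChiPseudoEisensteinSelfDualVectorGramCMTwo   -- ★ p860772 (this seat): (SD) in vector-Gram currency
import Summits.HodgeConjecture.HodgeConjecture.Theorems.K2E1ChiSectionPlancherelSelfDualCMTwo        -- ★ p860386: `inner_mk_span_eq_integral` (+ ★ p860123 `inner_eq_integral_mul_conj`)
import Summits.HodgeConjecture.HodgeConjecture.Theorems.K2E1SpanOperatorOfEntries                    -- ★ p860844 (K2E4-p10): `exists_family_span_of_entries`
import HarnessLib

/-!
# (277) §3 — `K2E1ChiSectionPlancherelSDGramGeneralCMTwo`: THE `hSD` LETTER AT GENERAL RANK — `∃ M : ℂ → (W →ₗ W)` WITH `⟪ṽ_b, M z ṽ_a⟫ = B_z(φ_a,φ_b)` AND THE TWO-TERM GRAM IDENTITY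

Track B ∕ K2-LIT, crux h413 = `stmt-HodgeConjecture-24833`, route of record `HCCMUnconditional`; cell `hodgecm-mathlib`, squad K2, ENGINE E1.  THEOREMS ONLY (no `def`, no `instance`,
no `notation`, no named-fact hypothesis, no `sorry`); lane `--supports stmt-HodgeConjecture-24833 --as helper` (count-neutral).
THE MATHEMATICS ([MoeglinWaldspurger1995, II.2.1]; dealer (277) §3).  For a UNITARY SELF-DUAL `χ`, a finite family of continuous bounded `χ`-sections `φ_a` whose `L²(K_U)`-classes `v_a`
are LINEARLY INDEPENDENT, ★ `exists_family_span_of_entries` produces an operator family `M : ℂ → (W →ₗ W)`, `W = span{v_a}`, with prescribed entries `⟪ṽ_b, M z ṽ_a⟫ = B_z(φ_a,φ_b) :=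
(ν𝓕)⁻¹∫_{K_U} φ_a·conj I_{φ_b}(z̄,·) dμ_K`; with ★ VectorGram (`t`-integral outside) and ★ `inner_eq_integral_mul_conj` ∕ `inner_mk_span_eq_integral` this IS the `hSD` letter of ★ :184 for
the canonical representatives `y_{ia} = [θ_{f_{ia},φ_a}]` — at every rank, with NO package letter (the identification of `M z` with the scattering MATRIX `M(z,χ)` of rows 10∕12 is the
(KA)∕(B3) desk's, via the entries).
* **`exists_heckeM_and_hSD_cm_two`**.
HONEST LABEL: HC_CM is proved only modulo the 7 printed citations (2 remaining named inputs: hLiu418 = `stmt-HodgeConjecture-24832`, h413 = `stmt-HodgeConjecture-24833`) until rung 0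
closes; this file asserts no named fact, closes no socket; count-neutral; letter-free.

## References
* [MoeglinWaldspurger1995] C. Mœglin, J.-L. Waldspurger, *Spectral decomposition and Eisenstein series* (1995), II.2.1.
* [HornJohnson2013] R. A. Horn, C. R. Johnson, *Matrix Analysis*, 2nd ed. (2013), §0.6.
-/

set_option autoImplicit false
set_option linter.dupNamespace false  -- the mandated namespace repeats the summit's segment (`HodgeConjecture.HodgeConjecture`)

noncomputable section

open MeasureTheory Measure Set Filter Topology Complex NumberField IsDedekindDomain MulAction
open scoped Real NNReal ENNReal ComplexConjugate Pointwise InnerProductSpace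
open Literature.MeasureTheory.Group Literature.NumberTheory
open Literature.NumberTheory.Automorphic Literature.NumberTheory.Automorphic.UnitaryGroup AdelicGroupData
open Literature.NumberTheory.GaloisRepresentations (HeckeCharacter ideleGroup)
open Summit.HodgeConjecture.HodgeConjecture.Cruxes.H413.K2E1BorelEisensteinU
open Summit.HodgeConjecture.HodgeConjecture.Cruxes.H413.K2E1CharacterEisensteinU2Defs
open Summit.HodgeConjecture.HodgeConjecture.Cruxes.H413.K2E1ChiPseudoEisensteinSelfDualVectorGramCMTwo (chiPseudoEisenstein_inner_product_selfDual_vectorGram_cm_two)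
open Summit.HodgeConjecture.HodgeConjecture.Cruxes.H413.K2E1ChiSectionPlancherelSelfDualCMTwo (inner_mk_span_eq_integral)
open Summit.HodgeConjecture.HodgeConjecture.Cruxes.H413.K2E1ChiSectionPlancherelKTypeCMTwo (inner_eq_integral_mul_conj)
open Summit.HodgeConjecture.HodgeConjecture.Cruxes.H413.K2E1SpanOperatorOfEntries (exists_family_span_of_entries)

namespace Summit.HodgeConjecture.HodgeConjecture.Cruxes.H413.K2E1ChiSectionPlancherelSDGramGeneralCMTwo

/-- Bookkeeping (abstract over the analytic atoms, its own heartbeat budget): transport a two-term Gram identity along `Q = P`, `A′ = A` and `M_t = B_t`. [folklore] -/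
theorem gram_reshape {P Q A A' C c : ℂ} {m₁ m₂ m₃ Bf Mf : ℝ → ℂ}
    (h : P = C * (c * ∫ t : ℝ, m₁ t * (A * m₂ t + Bf t * m₃ t))) (e₁ : Q = P) (e₂ : A' = A) (hM : ∀ t, Mf t = Bf t) :
    Q = C * (c * ∫ t : ℝ, m₁ t * (A' * m₂ t + Mf t * m₃ t)) := by
  rw [e₁, h, e₂]
  simp_rw [hM]

variable (L : Type) [Field L] [NumberField L] [IsCMField L]
variable [MeasurableSpace (quasiSplit (↥(maximalRealSubfield L)) L (IsCMField.complexConj L) 2).Adelic] [BorelSpace (quasiSplit (↥(maximalRealSubfield L)) L (IsCMField.complexConj L) 2).Adelic]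
variable [MeasurableSpace (AdeleRing (𝓞 L) L)ˣ] [BorelSpace (AdeleRing (𝓞 L) L)ˣ]

/-- **`hSD` AT GENERAL RANK with `M z` := the operator of entries `B_z(φ_a,φ_b)`.**  Data as in ★ W-b; one `C > 0` such that for every UNITARY SELF-DUAL `χ`, every finite family of continuous
bounded `χ`-sections `φ_a` with LINEARLY INDEPENDENT `L²(K_U, μ_K)`-classes `v_a` (`v_a =ᵐ φ_a|_{K_U}`), profiles `f_{ia} ∈ C²_c((0,∞))`, `σ₀ > 1` and representatives `y_{ia} =ᵐ θ_{f_{ia},φ_a}`: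
there is `M : ℂ → (span{v_a} →ₗ[ℂ] span{v_a})` with `⟪ṽ_b, M z ṽ_a⟫ = (ν𝓕)⁻¹∫_{K_U} φ_a·conj I_{φ_b}(z̄,·) dμ_K` for ALL `z`, and the `hSD` Gram identity of ★ :184 holds with this `M`.
[cite: MoeglinWaldspurger1995, II.2.1] [cite: HornJohnson2013, §0.6] -/
theorem exists_heckeM_and_hSD_cm_two
    (μ : Measure (quasiSplit (↥(maximalRealSubfield L)) L (IsCMField.complexConj L) 2).automorphicQuotient) [(quasiSplit (↥(maximalRealSubfield L)) L (IsCMField.complexConj L) 2).IsAutomorphicMeasure μ]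
    (νG : Measure (quasiSplit (↥(maximalRealSubfield L)) L (IsCMField.complexConj L) 2).Adelic) [νG.IsHaarMeasure] [νG.IsInvInvariant]
    (μK : Measure ((standardMaximalCompactGL 2 L).comap (adelicVal (↥(maximalRealSubfield L)) L (IsCMField.complexConj L) 2 ((StdForm.antidiagonal 2).over L)) : Subgroup (quasiSplit (↥(maximalRealSubfield L)) L (IsCMField.complexConj L) 2).Adelic)) [μK.IsHaarMeasure]
    (νI : Measure (AdeleRing (𝓞 L) L)ˣ) [νI.IsHaarMeasure]
    {𝓕I : Set (AdeleRing (𝓞 L) L)ˣ} (h𝓕I : IsIdeleClassDomain L 𝓕I)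
    (ν : Measure ↥(adelicUnipotent (↥(maximalRealSubfield L)) L (IsCMField.complexConj L) 2)) [ν.IsHaarMeasure] {𝓕 : Set ↥(adelicUnipotent (↥(maximalRealSubfield L)) L (IsCMField.complexConj L) 2)}
    (h𝓕N : IsFundamentalDomain ↥(rationalUnipotent (↥(maximalRealSubfield L)) L (IsCMField.complexConj L) 2) 𝓕 ν) (h𝓕c : IsCompact (closure 𝓕)) (h𝓕₀ : ν 𝓕 ≠ 0) :
    ∃ C : ℝ, 0 < C ∧
      ∀ {ι α : Type*} [Fintype α] {χ : HeckeCharacter L} {φ : α → (quasiSplit (↥(maximalRealSubfield L)) L (IsCMField.complexConj L) 2).Adelic → ℂ} {f : ι → α → ℝ → ℂ} {σ₀ : ℝ}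
        (v : α → Lp ℂ 2 μK) (y : ι → α → Lp ℂ 2 μ),
        χ.IsUnitary → reflectChar (IsCMField.complexConj L) χ = χ →
        (∀ a, IsChiSection χ (φ a)) → (∀ a, Continuous (φ a)) → (∀ a, ∃ Cφ : ℝ, ∀ x, ‖φ a x‖ ≤ Cφ) →
        LinearIndependent ℂ v →
        (∀ i a, ContDiff ℝ 2 (f i a)) → (∀ i a, HasCompactSupport (f i a)) → (∀ i a, tsupport (f i a) ⊆ Ioi 0) → 1 < σ₀ →
        (∀ a, (v a : ((standardMaximalCompactGL 2 L).comap (adelicVal (↥(maximalRealSubfield L)) L (IsCMField.complexConj L) 2 ((StdForm.antidiagonal 2).over L)) : Subgroup (quasiSplit (↥(maximalRealSubfield L)) L (IsCMField.complexConj L) 2).Adelic) → ℂ) =ᵐ[μK] fun k => φ a (k : (quasiSplit (↥(maximalRealSubfield L)) L (IsCMField.complexConj L) 2).Adelic)) →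
        (∀ i a, (y i a : (quasiSplit (↥(maximalRealSubfield L)) L (IsCMField.complexConj L) 2).automorphicQuotient → ℂ) =ᵐ[μ] (quasiSplit (↥(maximalRealSubfield L)) L (IsCMField.complexConj L) 2).quotFun (eisensteinSeriesU (fun g : (quasiSplit (↥(maximalRealSubfield L)) L (IsCMField.complexConj L) 2).Adelic => f i a (borelHeight g : ℝ) * φ a g))) →
        ∃ M : ℂ → ↥(Submodule.span ℂ (Set.range v)) →ₗ[ℂ] ↥(Submodule.span ℂ (Set.range v)),
          (∀ z a b, ⟪(⟨v b, Submodule.subset_span ⟨b, rfl⟩⟩ : ↥(Submodule.span ℂ (Set.range v))), M z ⟨v a, Submodule.subset_span ⟨a, rfl⟩⟩⟫_ℂ = (((((ν 𝓕).toReal⁻¹ : ℝ)) : ℂ) * ∫ k : ((standardMaximalCompactGL 2 L).comap (adelicVal (↥(maximalRealSubfield L)) L (IsCMField.complexConj L) 2 ((StdForm.antidiagonal 2).over L)) : Subgroup (quasiSplit (↥(maximalRealSubfield L)) L (IsCMField.complexConj L) 2).Adelic), φ a (k : (quasiSplit (↥(maximalRealSubfield L)) L (IsCMField.complexConj L) 2).Adelic)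 * conj (∫ v : ↥(adelicUnipotent (↥(maximalRealSubfield L)) L (IsCMField.complexConj L) 2), flatSectionU (φ b) (conj z) (((quasiSplit (↥(maximalRealSubfield L)) L (IsCMField.complexConj L) 2).toAdelic (weylLongU ((IsCMField.complexConj L : L ≃ₐ[↥(maximalRealSubfield L)] L) : L →+* L) (rfl : (StdForm.antidiagonal 2).over L = (StdForm.antidiagonal 2).over L))) * ((v : (quasiSplit (↥(maximalRealSubfield L)) L (IsCMField.complexConj L) 2).Adelic) * (k : (quasiSplit (↥(maximalRealSubfield L)) L (IsCMField.complexConj L) 2).Adelic))) ∂ν) ∂μK)) ∧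
          ∀ i j a b, ⟪y i b, y j a⟫_ℂ = (C : ℂ) * ((((2 * π)⁻¹ : ℝ) : ℂ) * ∫ t : ℝ, mellin (f j a) (-((σ₀ : ℂ) + t * I)) *
            (⟪(⟨v b, Submodule.subset_span ⟨b, rfl⟩⟩ : ↥(Submodule.span ℂ (Set.range v))), ⟨v a, Submodule.subset_span ⟨a, rfl⟩⟩⟫_ℂ * conj (mellin (f i b) (-(1 - conj ((σ₀ : ℂ) + t * I)))) +
              ⟪(⟨v b, Submodule.subset_span ⟨b, rfl⟩⟩ : ↥(Submodule.span ℂ (Set.range v))), M ((σ₀ : ℂ) + t * I) ⟨v a, Submodule.subset_span ⟨a, rfl⟩⟩⟫_ℂ * conj (mellin (f i b) (-conj ((σ₀ : ℂ) + t * I))))) := by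
  have hH0 := chiPseudoEisenstein_inner_product_selfDual_vectorGram_cm_two L μ νG μK νI h𝓕I ν h𝓕N h𝓕c h𝓕₀
  refine ⟨Classical.choose hH0, (Classical.choose_spec hH0).1, ?_⟩
  intro ι α _ χ φ f σ₀ v y hχu hsd hφ hφc hφC hv hf hfs hf0 hσ₀ hvφ hy
  have hM := exists_family_span_of_entries hv (fun (z : ℂ) a b => (((((ν 𝓕).toReal⁻¹ : ℝ)) : ℂ) * ∫ k : ((standardMaximalCompactGL 2 L).comap (adelicVal (↥(maximalRealSubfield L)) L (IsCMField.complexConj L) 2 ((StdForm.antidiagonal 2).over L)) : Subgroup (quasiSplit (↥(maximalRealSubfield L)) L (IsCMField.complexConj L) 2).Adelic), φ a (k : (quasiSplit (↥(maximalRealSubfield L)) L (IsCMField.complexConj L) 2).Adelic) * conj (∫ v : ↥(adelicUnipotent (↥(maximalRealSubfield L)) L (IsCMField.complexConj L) 2), flatSectionU (φ b) (conj z) (((quasiSplit (↥(maximalRealSubfield L)) L (IsCMField.complexConj L) 2).toAdelic (weylLongU ((IsCMField.complexConj L : L ≃ₐ[↥(maximalRealSubfield L)] L) : L →+* L) (rfl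 : (StdForm.antidiagonal 2).over L = (StdForm.antidiagonal 2).over L))) * ((v : (quasiSplit (↥(maximalRealSubfield L)) L (IsCMField.complexConj L) 2).Adelic) * (k : (quasiSplit (↥(maximalRealSubfield L)) L (IsCMField.complexConj L) 2).Adelic))) ∂ν) ∂μK))
  refine ⟨Classical.choose hM, Classical.choose_spec hM, fun i j a b => ?_⟩
  exact gram_reshape (((Classical.choose_spec hH0).2 hχu hsd (hφ a) (hφc a) (hφC a).choose_spec (hφ b) (hφc b) (hφC b).choose_spec
      (hf j a) (hfs j a) (hf0 j a) (hf i b) (hfs i b) (hf0 i b) hσ₀).2)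
    (inner_eq_integral_mul_conj (y i b) (y j a) (hy i b) (hy j a))
    (inner_mk_span_eq_integral μK v (ψ := fun a (k : ((standardMaximalCompactGL 2 L).comap (adelicVal (↥(maximalRealSubfield L)) L (IsCMField.complexConj L) 2 ((StdForm.antidiagonal 2).over L)) : Subgroup (quasiSplit (↥(maximalRealSubfield L)) L (IsCMField.complexConj L) 2).Adelic)) => φ a (k : (quasiSplit (↥(maximalRealSubfield L)) L (IsCMField.complexConj L) 2).Adelic)) hvφ a b)
    (fun t => Classical.choose_spec hM ((σ₀ : ℂ) + t * I) a b)

end Summit.HodgeConjecture.HodgeConjecture.Cruxes.H413.K2E1ChiSectionPlancherelSDGramGeneralCMTwo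

end
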